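import Literature.NumberTheory.EllipticCurves.HeckeGrossencharakterFunctionalEquationConductor
import Literature.NumberTheory.LFunctions.ImaginaryQuadraticGrossencharakterFunctionalEquation
import Literature.NumberTheory.GaloisRepresentations.HeckeCharacterConductorRayPrimitive
import Literature.NumberTheory.GaloisRepresentations.HeckeLFunctionValueOfNegativeWeight
import HarnessLib

/-!
# Hecke's functional equation for a Größencharakter of type `(m, 0)` of an imaginary quadratic field, WITH ITS
# CONDUCTOR — PROOF of the named fact `Hecke_functionalEquation_infinityType_conductor`

Topic `Literature/NumberTheory/EllipticCurves`; namespace `Literature.NumberTheory.EllipticCurves`.  THEOREMS ONLY (no definition,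
no named fact, no instance, no `sorry`).  Companion PROOF file of `HeckeGrossencharakterFunctionalEquationConductor.lean`, whose named
fact (de Shalit II §1.1 (1)–(3); Neukirch VII (8.5)–(8.6); Hecke 1920) was recorded «statement only, no `_holds` (Tate's thesis /
Hecke's theta integral for characters of INFINITE order is not in the tree)».  The tree now has Hecke's theta integral for the
harmonic weight `σ_w^m` over an imaginary quadratic field (`LFunctions/HeckeThetaInversionComplexWeight`, `…/HeckeThetaComplexWeightMellin`,
`…/GrossencharakterFinitePartGaussSum`, `…/ImaginaryQuadraticGrossencharakterLSeries`, `…/ImaginaryQuadraticGrossencharakterDualSide`,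
★ `…/ImaginaryQuadraticGrossencharakterFunctionalEquation` — Neukirch's proof of VII (8.5) with the weight polynomial `σ_w(x)^m`), and
this file DISCHARGES the fact:

* `heckeLFunction_eq_rayClassLSeries_conductor` / `heckeLFunctionConj_eq_rayClassLSeries_conductor` — on `re s > m/2 + 1` the idelic
  Euler products `L(χ, s)`, `L(χ̄, s)` are the ideal-theoretic series `Σ_{(𝔞,𝔣)=1} χ̃(𝔞) N𝔞^{-s}` of the Größencharakter
  `χ̃ = idealPow (χ(ϖ_·))` modulo the CONDUCTOR `𝔣 = 𝔣(χ)` and of its conjugate (exponent `-m/2`, `heckeLFunction_eq_rayClassLSeries_of_norm_eq_rpow`;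
  the primes of `𝔣(χ)` are exactly the ramified places, `conductor_le_asIdeal_iff`);
* `hasEmbPowType_conductor` — `χ̃` has type `σ_w^m` on the ray modulo `𝔣(χ)` (`isGrossencharakter_valueAtUniformizer_conductor'`; one
  complex place, no real place);
* `isPrimitiveGross_conductor` — its finite part is PRIMITIVE modulo `𝔣(χ)` (`HeckeCharacter.conductor_eq_of_forall_idealPow_span_eq`);
* ★ `Hecke_functionalEquation_infinityType_conductor_holds` — the named fact, by `LFunctions.grossLSeries_functional_equation'`.

References: [deShalit1987] II §1.1 (1)–(3); [NeukirchANT1999] Ch. VII §6 (6.2), (6.11), §8 Thm. (8.5), Cor. (8.6); [HeckeMathZ1920].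
Filed for crux L of `Summits/BirchSwinnertonDyer` (the cite conjunct `Hecke_functionalEquation_infinityType_conductor` of line `rtt_w3`
becomes a theorem); nothing about BSD is proved here.

## Mathlib / tree search
Tree: everything named above; `norm_apply_eq_ideleNorm_rpow_of_hasInfinityType`, `isModulus_conductorExponentAt`, `mem_toFinset_ramifiedPlaces_iff`,
`rayClassCoeff_star`, `heckeLFunctionConj_eq_conj`, `grossFinitePart_of_isCoprime`.  Mathlib: `Complex.conj_tsum`, `Complex.cpow_conj`,
`Fintype.prod_subsingleton`, `card_add_two_mul_card_eq_rank`.  `lean search 'infinityType_conductor_holds'` (2026-09-01): none.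
-/

noncomputable section

open scoped NumberField ComplexConjugate Classical
open NumberField NumberField.InfinitePlace IsDedekindDomain
open Literature.NumberTheory.GaloisRepresentations Literature.NumberTheory.LFunctions

namespace Literature.NumberTheory.EllipticCurves

variable {K : Type} [Field K] [NumberField K]

/-! ### §1 Imaginary quadratic bookkeeping -/

/-- An imaginary quadratic field has exactly one infinite place (`r₁ + 2 r₂ = 2`, `r₁ = 0`).
[cite: NeukirchANT1999, Ch. I §5 (signature)] -/
private theorem subsingleton_infinitePlace (hK : IsImaginaryQuadratic K) : Subsingleton (InfinitePlace K) := by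
  obtain ⟨h2, hTC⟩ := hK
  have h := card_add_two_mul_card_eq_rank K
  rw [h2] at h
  have h0 : nrRealPlaces K = 0 := nrRealPlaces_eq_zero_iff.mpr hTC
  have hcard : Fintype.card (InfinitePlace K) = 1 := by
    rw [card_eq_nrRealPlaces_add_nrComplexPlaces]; omega
  exact Fintype.card_le_one_iff_subsingleton.mp hcard.le

omit [NumberField K] in
/-- A totally complex field has no real embedding. [cite: NeukirchANT1999, Ch. I §5 (signature)] -/
private theorem false_of_ringHom_real' [IsTotallyComplex K] (φ : K →+* ℝ) : False := by
  have hreal : ComplexEmbedding.IsReal (Complex.ofRealHom.comp φ) := by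
    rw [ComplexEmbedding.isReal_iff]
    ext x
    simp only [ComplexEmbedding.conjugate_coe_eq, RingHom.coe_comp, Function.comp_apply,
      Complex.ofRealHom_eq_coe, Complex.conj_ofReal]
  have h : (InfinitePlace.mk (Complex.ofRealHom.comp φ)).IsReal := ⟨_, hreal, rfl⟩
  exact InfinitePlace.not_isReal_iff_isComplex.2 (IsTotallyComplex.isComplex _) h

/-- A prime of `K` NOT dividing a nonzero ideal `𝔣` exists (a prime above any rational prime `ℓ > N𝔣`). [cite: NeukirchANT1999, Ch. I §8 (primes above `ℓ`)] -/
private theorem exists_not_le_asIdeal' {𝔣 : Ideal (𝓞 K)} (h𝔣 : 𝔣 ≠ ⊥) : ∃ w : HeightOneSpectrum (𝓞 K), ¬ 𝔣 ≤ w.asIdeal := by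
  classical
  obtain ⟨ℓ, hℓN, hℓ⟩ := Nat.exists_infinite_primes (Ideal.absNorm 𝔣 + 1)
  have hℓZ : Prime (ℓ : ℤ) := Nat.prime_iff_prime_int.mp hℓ
  haveI : (Ideal.span {(ℓ : ℤ)}).IsPrime := (Ideal.span_singleton_prime hℓZ.ne_zero).mpr hℓZ
  obtain ⟨Q, -, hQ, hQcomap⟩ := Ideal.exists_ideal_over_prime_of_isIntegral (S := 𝓞 K) (Ideal.span {(ℓ : ℤ)}) ⊥
    (by
      rw [← RingHom.ker_eq_comap_bot, (RingHom.injective_iff_ker_eq_bot _).mp (algebraMap ℤ (𝓞 K)).injective_int]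
      exact bot_le)
  have hℓQ : (ℓ : 𝓞 K) ∈ Q := by
    have : (ℓ : ℤ) ∈ Q.comap (algebraMap ℤ (𝓞 K)) := by rw [hQcomap]; exact Ideal.mem_span_singleton_self _
    rw [Ideal.mem_comap, map_natCast] at this
    exact this
  have hQ0 : Q ≠ ⊥ := by
    intro h0
    rw [h0, Ideal.mem_bot] at hℓQ
    exact hℓ.ne_zero (by exact_mod_cast hℓQ)
  refine ⟨⟨Q, hQ, hQ0⟩, fun hle ↦ ?_⟩
  have hdvd : Ideal.absNorm Q ∣ Ideal.absNorm 𝔣 := Ideal.absNorm_dvd_absNorm_of_le hle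
  have hℓdvd : ℓ ∣ Ideal.absNorm Q := by
    have h1 : Ideal.absNorm Q ∣ Ideal.absNorm (Ideal.span {(ℓ : 𝓞 K)}) :=
      Ideal.absNorm_dvd_absNorm_of_le ((Ideal.span_singleton_le_iff_mem _).mpr hℓQ)
    rw [Ideal.absNorm_span_singleton, ← map_natCast (algebraMap ℤ (𝓞 K)) ℓ, Algebra.norm_algebraMap, Int.natAbs_pow,
      Int.natAbs_natCast] at h1
    have hQ1 : Ideal.absNorm Q ≠ 1 := by
      rw [Ne, Ideal.absNorm_eq_one_iff]; exact hQ.ne_top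
    obtain ⟨i, -, hi⟩ := (Nat.dvd_prime_pow hℓ).mp h1
    rw [hi] at hQ1 ⊢
    rcases Nat.eq_zero_or_pos i with rfl | hi0
    · exact absurd (pow_zero ℓ) hQ1
    · exact dvd_pow_self ℓ hi0.ne'
  have hN0 : Ideal.absNorm 𝔣 ≠ 0 := by rw [Ne, Ideal.absNorm_eq_zero_iff]; exact h𝔣
  have := Nat.le_of_dvd (Nat.pos_of_ne_zero hN0) (hℓdvd.trans hdvd)
  omega

/-- `L_𝔪(χ̄, s) = conj L_𝔪(χ, s̄)` for the ideal-theoretic series, as unconditional sums (no convergence needed).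
[cite: NeukirchANT1999, Ch. VII §8 (8.1)] -/
private theorem rayClassLSeries_star' (𝔪 : Ideal (𝓞 K)) (ψ : HeightOneSpectrum (𝓞 K) → ℂ) (s : ℂ) :
    rayClassLSeries 𝔪 (star ψ) s = conj (rayClassLSeries 𝔪 ψ (conj s)) := by
  rw [rayClassLSeries, rayClassLSeries, Complex.conj_tsum]
  refine tsum_congr fun I ↦ ?_
  have hN : (((Ideal.absNorm I : ℕ) : ℂ)).arg ≠ Real.pi := by
    rw [Complex.natCast_arg]
    exact Real.pi_ne_zero.symm
  rw [rayClassCoeff_star, map_mul, ← map_neg, Complex.cpow_conj _ _ hN, Complex.conj_conj, Complex.conj_natCast]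

/-! ### §2 The exponent and the Dirichlet series of `L(χ, s)` -/

section Character

variable {χ : HeckeCharacter K} {m : ℕ}

/-- **A Hecke character of infinity type `(m, 0)` of an imaginary quadratic field has exponent `-m/2`**: `|χ(x)| = ‖x‖^{-m/2}`
for every idele `x` (purity: weight `m`, `[K_w:ℝ] = 2`). [cite: Weil1956, §1] [cite: deShalit1987, II.1.1] -/
theorem norm_apply_eq_ideleNorm_rpow_of_infinityType (hK : IsImaginaryQuadratic K)
    (hχ : χ.HasInfinityType (fun _ ↦ (m : ℤ)) (fun _ ↦ 0)) (x : ideleGroup K) :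
    ‖((χ x : ℂˣ) : ℂ)‖ = ideleNorm x ^ (-(m : ℝ) / 2) := by
  classical
  haveI := hK.2
  have hmod := HeckeCharacter.isModulus_conductorExponentAt χ
  obtain ⟨v₀, hv₀⟩ := exists_not_le_asIdeal' χ.conductor_ne_bot
  have hv₀T : v₀ ∉ (HeckeCharacter.finite_ramifiedPlaces_holds χ).toFinset := by
    rw [HeckeCharacter.mem_toFinset_ramifiedPlaces_iff, not_not]
    have h := (HeckeCharacter.conductor_le_asIdeal_iff χ v₀).not.mp hv₀
    rwa [not_not] at h
  have h := HeckeCharacter.norm_apply_eq_ideleNorm_rpow_of_hasInfinityType hχ hmod (wt := (m : ℤ))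
    (fun v ↦ by rw [mult_isComplex ⟨v, IsTotallyComplex.isComplex v⟩]; push_cast; ring) hv₀T x
  rw [h]
  norm_cast

/-- The primes of the conductor are exactly the ramified places, in the shape wanted by
`heckeLFunction_eq_rayClassLSeries_of_norm_eq_rpow`. [cite: NeukirchANT1999, Ch. VII §6 (6.10)–(6.11)] -/
theorem isUnramifiedAt_iff_not_conductor_le (χ : HeckeCharacter K) (v : HeightOneSpectrum (𝓞 K)) :
    χ.IsUnramifiedAt v ↔ ¬ χ.conductor ≤ v.asIdeal := by
  rw [HeckeCharacter.conductor_le_asIdeal_iff, not_not]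

/-- **`L(χ, s) = Σ_{(𝔞, 𝔣(χ)) = 1} χ̃(𝔞) N𝔞^{-s}`** on `re s > m/2 + 1` for `χ` of type `(m, 0)` of an imaginary quadratic field: the
idelic Euler product is the ideal-theoretic series modulo the conductor. [cite: NeukirchANT1999, Ch. VII §8 (8.1) Proposition] [cite: deShalit1987, II.1.1] -/
theorem heckeLFunction_eq_rayClassLSeries_conductor (hK : IsImaginaryQuadratic K)
    (hχ : χ.HasInfinityType (fun _ ↦ (m : ℤ)) (fun _ ↦ 0)) {s : ℂ} (hs : (m : ℝ) / 2 + 1 < s.re) :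
    heckeLFunction χ s = rayClassLSeries χ.conductor (fun v ↦ (χ.valueAtUniformizer v : ℂ)) s :=
  HeckeCharacter.heckeLFunction_eq_rayClassLSeries_of_norm_eq_rpow (norm_apply_eq_ideleNorm_rpow_of_infinityType hK hχ)
    χ.conductor_ne_bot (isUnramifiedAt_iff_not_conductor_le χ) (by linarith)

/-- **`L(χ̄, s) = Σ_{(𝔞, 𝔣(χ)) = 1} conj χ̃(𝔞) N𝔞^{-s}`** on `re s > m/2 + 1` (the series of `star (χ(ϖ_·))`).
[cite: deShalit1987, II.1.1 (3) (the dual side)] -/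
theorem heckeLFunctionConj_eq_rayClassLSeries_conductor (hK : IsImaginaryQuadratic K)
    (hχ : χ.HasInfinityType (fun _ ↦ (m : ℤ)) (fun _ ↦ 0)) {s : ℂ} (hs : (m : ℝ) / 2 + 1 < s.re) :
    heckeLFunctionConj χ s = rayClassLSeries χ.conductor (star fun v ↦ (χ.valueAtUniformizer v : ℂ)) s := by
  have hs' : (m : ℝ) / 2 + 1 < (conj s).re := by rwa [Complex.conj_re]
  rw [heckeLFunctionConj_eq_conj, heckeLFunction_eq_rayClassLSeries_conductor hK hχ hs', rayClassLSeries_star']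

/-! ### §3 The Größencharakter `χ̃ mod 𝔣(χ)`: type `σ_w^m`, primitive -/

/-- **`χ̃ = idealPow (χ(ϖ_·))` has type `σ_w^m` on the ray modulo the conductor** (`χ̃((b)) σ_w(c)^m = χ̃((c)) σ_w(b)^m` for nonzero
`b ≡ c mod 𝔣(χ)`, `c` prime to `𝔣(χ)`; `w` the complex place). [cite: NeukirchANT1999, Ch. VII §6 (6.11), Prop. (6.13), Cor. (6.14)] -/
theorem hasEmbPowType_conductor (hK : IsImaginaryQuadratic K) (w : {w : InfinitePlace K // IsComplex w})
    (hχ : χ.HasInfinityType (fun _ ↦ (m : ℤ)) (fun _ ↦ 0)) :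
    HasEmbPowType χ.conductor w.1.embedding m (fun v ↦ (χ.valueAtUniformizer v : ℂ)) := by
  haveI := hK.2
  haveI := subsingleton_infinitePlace hK
  have hG := HeckeCharacter.isGrossencharakter_valueAtUniformizer_conductor' hχ
  refine ⟨hG.ne_zero, fun b c hb hc hcop hbc ↦ ?_⟩
  have hc' : (c : K) ≠ 0 := fun h ↦ hc (by exact_mod_cast h)
  have h := hG.idealPow_span_eq b c hb hc hcop hbc (fun φ ↦ (false_of_ringHom_real' φ).elim)
  rw [Fintype.prod_subsingleton _ w.1] at h
  simp only [zpow_zero, mul_one, zpow_natCast] at h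
  rw [h, map_div₀, div_pow, mul_assoc, div_mul_cancel₀ _ (pow_ne_zero _ ((map_ne_zero _).mpr hc'))]

/-- **The finite part of `χ̃ mod 𝔣(χ)` is PRIMITIVE** (the conductor is the smallest module of definition).
[cite: NeukirchANT1999, Ch. VII §6 Def. (6.2), (6.11)] -/
theorem isPrimitiveGross_conductor (hK : IsImaginaryQuadratic K) (w : {w : InfinitePlace K // IsComplex w})
    (hχ : χ.HasInfinityType (fun _ ↦ (m : ℤ)) (fun _ ↦ 0)) :
    IsPrimitiveGross χ.conductor (fun v ↦ (χ.valueAtUniformizer v : ℂ)) w.1.embedding m := by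
  haveI := hK.2
  haveI := subsingleton_infinitePlace hK
  refine ⟨fun 𝔪' hle hne ↦ ?_⟩
  by_contra hcon
  push Not at hcon
  refine hne (HeckeCharacter.conductor_eq_of_forall_idealPow_span_eq hχ hle fun b hb hcop hb1 ↦ ?_)
  have hb' : (b : K) ≠ 0 := fun h ↦ hb (by exact_mod_cast h)
  have h := hcon b hb hcop hb1
  rw [grossFinitePart_of_isCoprime hb hcop, div_eq_one_iff_eq (pow_ne_zero _ ((map_ne_zero _).mpr hb'))] at h
  rw [Fintype.prod_subsingleton _ w.1]
  simp only [zpow_zero, mul_one, zpow_natCast]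
  exact h

end Character

/-! ### §4 The named fact holds -/

/-- ★★ **Hecke's functional equation for a Größencharakter of infinity type `(m, 0)`, `m ≥ 1`, of an imaginary quadratic field, WITH ITS
CONDUCTOR, HOLDS** (de Shalit II §1.1 (1)–(3); Neukirch VII (8.5)–(8.6); Hecke 1920): `R(χ, s) = (d_K N𝔣_χ)^{s/2} (2π)^{-s} Γ(s) L(χ, s)`
and `R(χ̄, s)` are entire and `R(χ, s) = W · R(χ̄, m + 1 - s)`, `|W| = 1`.  Discharges the named fact
`Hecke_functionalEquation_infinityType_conductor` of `HeckeGrossencharakterFunctionalEquationConductor.lean` by the ideal-theoretic theorem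
`LFunctions.grossLSeries_functional_equation'` (Hecke's theta integral with the harmonic weight `σ_w^m`) applied to `χ̃ mod 𝔣(χ)`.
[cite: deShalit1987, II.1.1 (1)–(3)] [cite: NeukirchANT1999, Ch. VII §8 Thm. (8.5), Cor. (8.6)] [cite: HeckeMathZ1920, §§1–2] -/
theorem Hecke_functionalEquation_infinityType_conductor_holds : Hecke_functionalEquation_infinityType_conductor := by
  intro K _ _ hK χ m hm hχ
  haveI := hK.2
  obtain ⟨w₀⟩ := (inferInstance : Nonempty (InfinitePlace K))
  set w : {w : InfinitePlace K // IsComplex w} := ⟨w₀, IsTotallyComplex.isComplex w₀⟩ with hw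
  have hψ := hasEmbPowType_conductor hK w hχ
  have hprim := isPrimitiveGross_conductor hK w hχ
  obtain ⟨W, Λ, Λ', hW, hΛ, hΛ', hval, hfe⟩ :=
    grossLSeries_functional_equation' w hK.1 hψ hprim (Nat.one_le_iff_ne_zero.mpr hm.ne') χ.conductor_ne_bot
  refine ⟨W, Λ, Λ', hW, hΛ, hΛ', fun s hs ↦ ?_, hfe⟩
  obtain ⟨h1, h2⟩ := hval s hs
  rw [heckeLFunction_eq_rayClassLSeries_conductor hK hχ hs, heckeLFunctionConj_eq_rayClassLSeries_conductor hK hχ hs]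
  exact ⟨h1, h2⟩

end Literature.NumberTheory.EllipticCurves

end
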